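import Summits.HodgeConjecture.HodgeConjecture.Theorems.R90S4TwistedTubeFibres              -- (B1-T) part 2a (this seat): (LI), (FC), equivariance/continuity, twisted-Weyl separation `exists_normWindow_injOn_epsTube`
import Summits.HodgeConjecture.HodgeConjecture.Theorems.R90S4EquivariantFamilyTubeJacobian     -- ★ p864154 (this seat) M2♭: `integrable_and_integral_eq_of_tubeJacobian_local` (brings ★ M2 p864068, ★ FibreCountPullback `measurableSet_image_inter_of_locallyInjOn`)
import Summits.HodgeConjecture.HodgeConjecture.Theorems.R90S4CartanMeasures                    -- ★ `cartanWeight`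
import HarnessLib

/-!
# R90-TF · S4 «Ch. 13.1–2», T-WIF road, (B1-T) part 2b — THE PER-SHEET TWISTED JACOBIAN LETTER (J̃♭) FEEDS ★ M2♭: the local tube Jacobian over the sheeted transversal and
# THE BOCHNER RADIAL IDENTITY ON `B₀` (Rogawski 1990, §12.5 p. 186)

Cell `hodgecm-mathlib`, crux H413 (`stmt-HodgeConjecture-24833`, lane `--supports … --as helper`), route of record `HCCMUnconditional` (no route verbs;
count-neutral).  Programme R90-TF, section S4 = [Rogawski1990] Ch. 13.1–13.2; seat R90-C131-p03 (g3); plan of record S4-R30∕S4-R33; (J̃♭) consumption bytes of record = R90 bus 2026-09-05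
02:06:56Z (3) (S4-R36∕S4-R44: the (TJ5) payer's head).  THEOREMS ONLY — no `def`, no instance, no notation, no named-fact hypothesis, no `sorry`; ★-only imports.

HONEST LABEL: HC_CM is proved only modulo the 7 printed citations (2 remaining named inputs: hLiu418 = stmt-HodgeConjecture-24832, h413 =
stmt-HodgeConjecture-24833) until rung 0 closes.  CONDITIONAL on the letters (L2) (Borel norm section `s`), the `K_T`-representatives `R`, the weight reading `Wt`, and (J̃♭) (the twisted tube
Jacobian per sheet, hypothesis `hJac`) — all hypotheses; discharges no socket (REL ≠ ★ ≠ BUILT).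

## The mathematics

SETTING as in parts 1∕2a (`Φ₃ = splitFormGL L`, `v` non-split; `T = Z_{G_v}(γ₀)`, `T̃ = Cent_{G̃_v}(γ₀)`, ε-regular base point `δ₀ ∈ T̃`, `T′ = G̃_{δ₀ε}` with a Haar measure `τ′`,
`μ₀ := νGt ∕ τ′` on `G̃_v ⧸ T′` (★ `quotientMeasure`), `Ψ(xT′, b) = x b ε(x)⁻¹`, `Ñ^ε_T` via `hN'`, `w_T = [Ñ^ε_T : T̃]`, norm section `s`, representatives `R`, sheeted transversal
`B₀ = ⋃_{u ∈ R} s(T^{reg}) u`, `D = {(q, b) | b ∈ B₀}`), plus: a σ-finite measure `t_T` on `T`, the SHEET MEASURE `λ := Σ_{u ∈ R} (t ↦ s t · u)_*(t_T|_{T^{reg}})` on `T̃` (part 1 §3), and a Borel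
weight `Wt` on `T̃` reading ★ `cartanWeight T` through the sheets (`Wt (s t · u) = cartanWeight T t`, hypothesis `hWt`).
* §1 (J̃♭) PER SHEET ⇒ ★ M2♭'s `hJac` ON `S = T̃`, `S₀ = B₀`, `lam = λ`, `W = Wt`.  THE LETTER `hJac` (bytes of record): for every regular `t₁ ∈ T` an open `U ∋ t₁` in `T` and a Borel
  `A₀ ⊆ G̃_v ⧸ T′` with `0 < μ₀(A₀) < ⊤` such that FOR EVERY SHEET `u ∈ R` and every Borel `V ⊆ U ∩ T^{reg}`: `νGt(Ψ(A₀ × s(V)·u)) = μ₀(A₀) · ∫⁻_V D_T dt_T` (`D_T = cartanWeight T`;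
  p. 186 «`D_G(N(δ))² dδ`», sheet by sheet; NO injectivity clause — part 2a's separation pays it).  CONVERSION: given `s₀ = s(t₁) u₁ ∈ B₀`, take the NORM WINDOW
  `U′ := {b ∈ T̃ | N b ∈ O ∩ O₁}` with `O` the separation window of part 2a at `t₁` and `O₁ ⊆ G̃_v` open with `ι⁻¹(O₁) = U` (`T ↪ G_v ↪ G̃_v` carry induced topologies); `U′` is open
  (`N` continuous), contains `s₀` (`N(s t u) = ι t`), `Ψ` is injective on `(A₀ × U′) ∩ D`, a Borel `V′ ⊆ U′ ∩ B₀` is the disjoint union of its sheets `s(V_u) u` with `V_u ⊆ U ∩ T^{reg}`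
  Borel, the tubes over distinct sheets are disjoint (injectivity) and Borel (★ `measurableSet_image_inter_of_locallyInjOn`), so `νGt(Ψ(A₀ × V′)) = Σ_u μ₀(A₀) ∫⁻_{V_u} D_T`, while
  `∫⁻_{V′} Wt dλ = Σ_u ∫⁻_{V_u} D_T dt_T` (part 1 `lintegral_sheetMeasure` + `hWt`).
* §2 THE BOCHNER RADIAL IDENTITY ON `B₀` (★ M2♭ §2 `integrable_and_integral_eq_of_tubeJacobian_local` with part 2a's (LI), (FC), continuity∕equivariance and §1): for `g : G̃_v → E`
  `νGt`-integrable on the tube `Ψ(D)`, `(b, q) ↦ g(Ψ(q, b))` is integrable for `((λ|_{B₀}) · Wt) ⊗ μ₀` and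
  **`∫_{b ∈ B₀} Wt(b) • ∫_{G̃_v ⧸ T′} g(Ψ(q, b)) dμ₀(q) dλ(b) = w_T • ∫_{Ψ(D)} g dνGt`**.
Part 3 (`R90S4TwistedTubeFormula`) identifies the inner integral through ★ β's CAN-ID (there `τ′(compact core) = 1` enters) and unpacks `λ` sheet by sheet.

[cite: Rogawski1990, §12.5 p. 186; §3.11 Prop. 3.11.2 pp. 34–35; §4.3 p. 43] [cite: HarishChandra1970, Lemma 22; Lemma 42] [cite: Federer1969, §2.10.10]
-/

set_option autoImplicit false
-- the mandated namespace repeats the single-problem summit's segment (`HodgeConjecture.HodgeConjecture`)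
set_option linter.dupNamespace false

noncomputable section

open MeasureTheory Measure Set Filter Topology Function NumberField IsDedekindDomain
open scoped ENNReal NNReal MatrixGroups Pointwise

namespace Summit.HodgeConjecture.HodgeConjecture.R90.S4

open Literature.NumberTheory.Rogawski1990 Literature.NumberTheory.Rogawski1990.Ch4Sec10
open Literature.NumberTheory.Automorphic Literature.NumberTheory.Automorphic.UnitaryGroup
open Literature.MeasureTheory.Group
open Summit.HodgeConjecture.HodgeConjecture.Cruxes.H413.F0P3cStCharTSWeylCartanRadial

section Radial

variable {L : Type} [Field L] [NumberField L] [IsCMField L] {v : HeightOneSpectrum (𝓞 ↥(maximalRealSubfield L))}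
  (hns : ∀ w : PlacesOver L v, IsCMField.complexConj L • w.1 = w.1)
  {T : Subgroup ((UnitaryGroup.cmDatum L 3 (splitFormGL L : Matrix (Fin 3) (Fin 3) L)).Local v)}
  {γ₀ : (UnitaryGroup.cmDatum L 3 (splitFormGL L : Matrix (Fin 3) (Fin 3) L)).Local v} (hγ₀ : IsRegularElt (γ₀.val : GtLoc L v))
  (hT : T = Subgroup.centralizer ({γ₀} : Set ((UnitaryGroup.cmDatum L 3 (splitFormGL L : Matrix (Fin 3) (Fin 3) L)).Local v)))
  [LocallyCompactSpace (GtLoc L v)] [SecondCountableTopology (GtLoc L v)] [T2Space (GtLoc L v)] [MeasurableSpace (GtLoc L v)] [BorelSpace (GtLoc L v)]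
  [∀ δ : GtLoc L v, MeasurableSpace (GtLoc L v ⧸ epsCentralizer (epsLoc L (splitFormGL L) v) δ)]
  [∀ δ : GtLoc L v, BorelSpace (GtLoc L v ⧸ epsCentralizer (epsLoc L (splitFormGL L) v) δ)]
  [MeasurableSpace ((UnitaryGroup.cmDatum L 3 (splitFormGL L : Matrix (Fin 3) (Fin 3) L)).Local v)] [BorelSpace ((UnitaryGroup.cmDatum L 3 (splitFormGL L : Matrix (Fin 3) (Fin 3) L)).Local v)]
  {δ₀ : GtLoc L v} (hδ₀T : δ₀ ∈ Subgroup.centralizer ({(γ₀.val : GtLoc L v)} : Set (GtLoc L v))) (hδ₀reg : IsEpsRegularAt L (splitFormGL L) v δ₀)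
  (Ψ : (GtLoc L v ⧸ epsCentralizer (epsLoc L (splitFormGL L) v) δ₀) × ↥(Subgroup.centralizer ({(γ₀.val : GtLoc L v)} : Set (GtLoc L v))) → GtLoc L v)
  (hΨ : ∀ (x : GtLoc L v) (b : ↥(Subgroup.centralizer ({(γ₀.val : GtLoc L v)} : Set (GtLoc L v)))), Ψ (QuotientGroup.mk x, b) = x * b * (epsLoc L (splitFormGL L) v x)⁻¹)
  (N' : Subgroup (GtLoc L v))
  (hN' : ∀ m, m ∈ N' ↔ m ∈ Subgroup.normalizer ((Subgroup.centralizer ({(γ₀.val : GtLoc L v)} : Set (GtLoc L v)) : Subgroup (GtLoc L v)) : Set (GtLoc L v)) ∧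
    m * (epsLoc L (splitFormGL L) v m)⁻¹ ∈ Subgroup.centralizer ({(γ₀.val : GtLoc L v)} : Set (GtLoc L v)))
  (s : ↥T → ↥(Subgroup.centralizer ({(γ₀.val : GtLoc L v)} : Set (GtLoc L v)))) (hsm : Measurable s)
  (hsN : ∀ t : ↥T, epsNorm (epsLoc L (splitFormGL L) v) (s t : GtLoc L v) = ((t : (UnitaryGroup.cmDatum L 3 (splitFormGL L : Matrix (Fin 3) (Fin 3) L)).Local v)).val)
  (R : Finset ↥(Subgroup.centralizer ({(γ₀.val : GtLoc L v)} : Set (GtLoc L v))))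
  (hRN : ∀ u ∈ R, epsNorm (epsLoc L (splitFormGL L) v) (u : GtLoc L v) = 1)
  (hRcov : ∀ w : ↥(Subgroup.centralizer ({(γ₀.val : GtLoc L v)} : Set (GtLoc L v))), epsNorm (epsLoc L (splitFormGL L) v) (w : GtLoc L v) = 1 →
    ∃ u ∈ R, ∃ a : ↥(Subgroup.centralizer ({(γ₀.val : GtLoc L v)} : Set (GtLoc L v))), (w : GtLoc L v) = u * (a * (epsLoc L (splitFormGL L) v a)⁻¹))
  (hRinj : ∀ u ∈ R, ∀ u' ∈ R, (∃ a : ↥(Subgroup.centralizer ({(γ₀.val : GtLoc L v)} : Set (GtLoc L v))),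
    ((u' : ↥(Subgroup.centralizer ({(γ₀.val : GtLoc L v)} : Set (GtLoc L v)))) : GtLoc L v) = u * (a * (epsLoc L (splitFormGL L) v a)⁻¹)) → u = u')
  (tT : Measure ↥T) [SigmaFinite tT]
  (Wt : ↥(Subgroup.centralizer ({(γ₀.val : GtLoc L v)} : Set (GtLoc L v))) → ℝ≥0) (hWtm : Measurable Wt)
  (hWt : ∀ t : ↥T, ∀ u ∈ R, Wt (s t * u) = cartanWeight L v T t)
  (τ' : Measure ↥(epsCentralizer (epsLoc L (splitFormGL L) v) δ₀)) [τ'.IsHaarMeasure] [τ'.IsInvInvariant]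

/-! ## §1 The per-sheet Jacobian letter (J̃♭) ⇒ ★ M2♭'s local tube Jacobian over the sheeted transversal -/

set_option maxHeartbeats 800000 in
-- instance-term unification on the CM local carrier (`G̃_v ⧸ T′`, `quotientMeasure`), as in ★ (E1b) `F0P3cStCharTSWeylCartanJacobian`
omit [SigmaFinite tT] in
include hns hγ₀ hT hδ₀T hδ₀reg hΨ hN' hsm hsN hRN hRinj hWtm hWt in
/-- **(J̃♭) PER SHEET ⇒ ★ M2♭'s LOCAL TUBE JACOBIAN over `S = T̃`, `S₀ = B₀`, `lam = Σ_u (t ↦ s t · u)_*(t_T|_{T^{reg}})`, `W = Wt`.**  THE LETTER `hJac` (bytes of record, R90 bus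
2026-09-05 02:06:56Z (3)): for every regular `t₁ ∈ T` an open `U ∋ t₁` in `T` and a Borel `A₀ ⊆ G̃_v ⧸ T′` with `0 < μ₀(A₀) < ⊤` such that for EVERY sheet `u ∈ R` and every Borel
`V ⊆ U ∩ T^{reg}`: `νGt(Ψ(A₀ × s(V)·u)) = μ₀(A₀) · ∫⁻_V D_T dt_T`.  CONCLUSION: ★ M2♭'s `hJac` at every `s₀ ∈ B₀`, on the norm window `U′ = N⁻¹(O ∩ O₁)` (`O` = part 2a's separation
window, `ι⁻¹ O₁ = U`), with injectivity on `(A₀ × U′) ∩ D` from part 2a and the measure identity summed over the (disjoint, Borel) tubes of the sheets of `V′`.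
[cite: Rogawski1990, §12.5 p. 186] [cite: HarishChandra1970, Lemma 22; Lemma 42] [cite: Federer1969, §2.10.10] -/
theorem hJac_sheet_to_radial (νGt : Measure (GtLoc L v)) [νGt.IsHaarMeasure] [νGt.IsMulRightInvariant]
    (hJac : ∀ t₁ : ↥T, IsRegularElt (((t₁ : (UnitaryGroup.cmDatum L 3 (splitFormGL L : Matrix (Fin 3) (Fin 3) L)).Local v)).val : GtLoc L v) →
      ∃ U : Set ↥T, IsOpen U ∧ t₁ ∈ U ∧
      ∃ A₀ : Set (GtLoc L v ⧸ epsCentralizer (epsLoc L (splitFormGL L) v) δ₀), MeasurableSet A₀ ∧ (quotientMeasure (epsCentralizer (epsLoc L (splitFormGL L) v) δ₀) τ' (isClosed_epsCentralizer L (splitFormGL L) v δ₀) νGt) A₀ ≠ 0 ∧ (quotientMeasure (epsCentralizer (epsLoc L (splitFormGL L) v) δ₀) τ' (isClosed_epsCentralizer L (splitFormGL L) v δ₀) νGt) A₀ ≠ ⊤ ∧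
        ∀ u ∈ R, ∀ V : Set ↥T, MeasurableSet V → V ⊆ U ∩ {t : ↥T | IsRegularElt (((t : (UnitaryGroup.cmDatum L 3 (splitFormGL L : Matrix (Fin 3) (Fin 3) L)).Local v)).val : GtLoc L v)} →
          νGt (Ψ '' (A₀ ×ˢ ((fun t : ↥T => s t * u) '' V))) = (quotientMeasure (epsCentralizer (epsLoc L (splitFormGL L) v) δ₀) τ' (isClosed_epsCentralizer L (splitFormGL L) v δ₀) νGt) A₀ * ∫⁻ t in V, (cartanWeight L v T t : ℝ≥0∞) ∂tT) :
    ∀ s₀ ∈ {b : ↥(Subgroup.centralizer ({(γ₀.val : GtLoc L v)} : Set (GtLoc L v))) | ∃ t : ↥T, IsRegularElt (((t : (UnitaryGroup.cmDatum L 3 (splitFormGL L : Matrix (Fin 3) (Fin 3) L)).Local v)).val : GtLoc L v) ∧ ∃ u ∈ R, b = s t * u},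
      ∃ U' : Set ↥(Subgroup.centralizer ({(γ₀.val : GtLoc L v)} : Set (GtLoc L v))), IsOpen U' ∧ s₀ ∈ U' ∧
      ∃ A₀ : Set (GtLoc L v ⧸ epsCentralizer (epsLoc L (splitFormGL L) v) δ₀), MeasurableSet A₀ ∧ (quotientMeasure (epsCentralizer (epsLoc L (splitFormGL L) v) δ₀) τ' (isClosed_epsCentralizer L (splitFormGL L) v δ₀) νGt) A₀ ≠ 0 ∧ (quotientMeasure (epsCentralizer (epsLoc L (splitFormGL L) v) δ₀) τ' (isClosed_epsCentralizer L (splitFormGL L) v δ₀) νGt) A₀ ≠ ⊤ ∧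
        InjOn Ψ ((A₀ ×ˢ U') ∩ {p | p.2 ∈ {b : ↥(Subgroup.centralizer ({(γ₀.val : GtLoc L v)} : Set (GtLoc L v))) | ∃ t : ↥T, IsRegularElt (((t : (UnitaryGroup.cmDatum L 3 (splitFormGL L : Matrix (Fin 3) (Fin 3) L)).Local v)).val : GtLoc L v) ∧ ∃ u ∈ R, b = s t * u}}) ∧
        ∀ V' : Set ↥(Subgroup.centralizer ({(γ₀.val : GtLoc L v)} : Set (GtLoc L v))), MeasurableSet V' → V' ⊆ U' ∩ {b : ↥(Subgroup.centralizer ({(γ₀.val : GtLoc L v)} : Set (GtLoc L v))) | ∃ t : ↥T, IsRegularElt (((t : (UnitaryGroup.cmDatum L 3 (splitFormGL L : Matrix (Fin 3) (Fin 3) L)).Local v)).val : GtLoc L v) ∧ ∃ u ∈ R, b = s t * u} →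
          νGt (Ψ '' (A₀ ×ˢ V')) = (quotientMeasure (epsCentralizer (epsLoc L (splitFormGL L) v) δ₀) τ' (isClosed_epsCentralizer L (splitFormGL L) v δ₀) νGt) A₀ * ∫⁻ b in V', (Wt b : ℝ≥0∞) ∂(∑ u ∈ R, Measure.map (fun t : ↥T => s t * u) (tT.restrict {t : ↥T | IsRegularElt (((t : (UnitaryGroup.cmDatum L 3 (splitFormGL L : Matrix (Fin 3) (Fin 3) L)).Local v)).val : GtLoc L v)})) := by
  classical
  have hΦ := splitFormGL_isHermitian L
  -- uniqueness of the sheet decomposition of a point of `B₀` (no `set`∕`let` abbreviations in this file: they cost the heartbeat budget at `whnf`)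
  have huniq : ∀ (t t' : ↥T) (u u' : ↥(Subgroup.centralizer ({(γ₀.val : GtLoc L v)} : Set (GtLoc L v)))), u ∈ R → u' ∈ R → s t * u = s t' * u' → t = t' ∧ u = u' := by
    intro t t' u u' hu hu' h
    have hN := epsNorm_sheet hγ₀ s hsN R hRN t u hu
    have hN' := epsNorm_sheet hγ₀ s hsN R hRN t' u' hu'
    rw [h] at hN
    have htt : t = t' := Subtype.ext (Subtype.ext (hN.symm.trans hN'))
    subst htt
    exact ⟨rfl, mul_left_cancel h⟩
  intro s₀ hs₀
  obtain ⟨t₁, ht₁, u₁, hu₁, rfl⟩ := hs₀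
  obtain ⟨U, hUo, ht₁U, A₀, hA₀m, hA₀0, hA₀top, hJ⟩ := hJac t₁ ht₁
  -- the norm window: part 2a's separation window `O` at `t₁`, and the letter's `U` read in `G̃_v` (`T ↪ G_v ↪ G̃_v` induced topologies)
  obtain ⟨O, hOo, ht₁O, hinjO⟩ := exists_normWindow_injOn_epsTube hns hγ₀ hT hδ₀T hδ₀reg Ψ hΨ N' hN' s hsN R hRN hRinj t₁ ht₁
  have hind : Topology.IsInducing (fun t : ↥T => (((t : (UnitaryGroup.cmDatum L 3 (splitFormGL L : Matrix (Fin 3) (Fin 3) L)).Local v)).val : GtLoc L v)) :=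
    Topology.IsInducing.subtypeVal.comp Topology.IsInducing.subtypeVal
  obtain ⟨O₁, hO₁o, hO₁U⟩ := hind.isOpen_iff.1 hUo
  have htU : ∀ t : ↥T, (((t : (UnitaryGroup.cmDatum L 3 (splitFormGL L : Matrix (Fin 3) (Fin 3) L)).Local v)).val : GtLoc L v) ∈ O₁ ↔ t ∈ U := fun t => by
    rw [← hO₁U]; rfl
  have hU'o : IsOpen ((fun b : ↥(Subgroup.centralizer ({(γ₀.val : GtLoc L v)} : Set (GtLoc L v))) => epsNorm (epsLoc L (splitFormGL L) v) (b : GtLoc L v)) ⁻¹' (O ∩ O₁)) :=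
    (hOo.inter hO₁o).preimage (continuous_subtype_val.mul ((continuous_epsLoc L (splitFormGL L) v).comp continuous_subtype_val))
  have hsU' : ∀ t : ↥T, ∀ u ∈ R, s t * u ∈ (fun b : ↥(Subgroup.centralizer ({(γ₀.val : GtLoc L v)} : Set (GtLoc L v))) => epsNorm (epsLoc L (splitFormGL L) v) (b : GtLoc L v)) ⁻¹' (O ∩ O₁) ↔
      (((t : (UnitaryGroup.cmDatum L 3 (splitFormGL L : Matrix (Fin 3) (Fin 3) L)).Local v)).val : GtLoc L v) ∈ O ∩ O₁ := fun t u hu => by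
    rw [mem_preimage, epsNorm_sheet hγ₀ s hsN R hRN t u hu]
  -- injectivity on the patch, from the separation window
  have hinjP : InjOn Ψ ((A₀ ×ˢ ((fun b : ↥(Subgroup.centralizer ({(γ₀.val : GtLoc L v)} : Set (GtLoc L v))) => epsNorm (epsLoc L (splitFormGL L) v) (b : GtLoc L v)) ⁻¹' (O ∩ O₁))) ∩ {p | p.2 ∈ {b : ↥(Subgroup.centralizer ({(γ₀.val : GtLoc L v)} : Set (GtLoc L v))) | ∃ t : ↥T, IsRegularElt (((t : (UnitaryGroup.cmDatum L 3 (splitFormGL L : Matrix (Fin 3) (Fin 3) L)).Local v)).val : GtLoc L v) ∧ ∃ u ∈ R, b = s t * u}}) := by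
    refine hinjO.mono ?_
    rintro ⟨q, b⟩ ⟨⟨-, hb⟩, hbB⟩
    exact ⟨⟨mem_univ _, hb.1⟩, hbB⟩
  refine ⟨(fun b : ↥(Subgroup.centralizer ({(γ₀.val : GtLoc L v)} : Set (GtLoc L v))) => epsNorm (epsLoc L (splitFormGL L) v) (b : GtLoc L v)) ⁻¹' (O ∩ O₁), hU'o, (hsU' t₁ u₁ hu₁).2 ⟨ht₁O, (htU t₁).2 ht₁U⟩,
    A₀, hA₀m, hA₀0, hA₀top, hinjP, fun V' hV'm hV'sub => ?_⟩
  -- the sheets of `V′`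
  let Vu : ↥(Subgroup.centralizer ({(γ₀.val : GtLoc L v)} : Set (GtLoc L v))) → Set ↥T := fun u => (fun t : ↥T => s t * u) ⁻¹' V' ∩ (U ∩ {t : ↥T | IsRegularElt (((t : (UnitaryGroup.cmDatum L 3 (splitFormGL L : Matrix (Fin 3) (Fin 3) L)).Local v)).val : GtLoc L v)})
  have hVum : ∀ u, MeasurableSet (Vu u) := fun u => by
    obtain ⟨w⟩ := (inferInstance : Nonempty (PlacesOver L v))
    have hregm : MeasurableSet {t : ↥T | IsRegularElt (((t : (UnitaryGroup.cmDatum L 3 (splitFormGL L : Matrix (Fin 3) (Fin 3) L)).Local v)).val : GtLoc L v)} :=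
      ((isOpen_setOf_isRegularElt_cmDatum_local (L := L) (H := (splitFormGL L : Matrix (Fin 3) (Fin 3) L)) (v := v) w (hns w)).preimage continuous_subtype_val).measurableSet
    exact ((hsm.mul_const u) hV'm).inter (hUo.measurableSet.inter hregm)
  have hVusub : ∀ u, Vu u ⊆ U ∩ {t : ↥T | IsRegularElt (((t : (UnitaryGroup.cmDatum L 3 (splitFormGL L : Matrix (Fin 3) (Fin 3) L)).Local v)).val : GtLoc L v)} := fun u t ht => ht.2
  -- every point of `V′` lies on exactly one sheet over `U ∩ T^{reg}`
  have hmemV' : ∀ b, b ∈ V' ↔ ∃ u ∈ R, ∃ t ∈ Vu u, b = s t * u := by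
    intro b
    constructor
    · intro hb
      obtain ⟨hbU', t, ht, u, hu, rfl⟩ := hV'sub hb
      exact ⟨u, hu, t, ⟨hb, (htU t).1 ((hsU' t u hu).1 hbU').2, ht⟩, rfl⟩
    · rintro ⟨u, -, t, ht, rfl⟩
      exact ht.1
  have hV'eq : V' = ⋃ u ∈ R, (fun t : ↥T => s t * u) '' Vu u := by
    ext b
    rw [hmemV']
    simp only [mem_iUnion, mem_image, exists_prop]
    constructor
    · rintro ⟨u, hu, t, ht, rfl⟩; exact ⟨u, hu, t, ht, rfl⟩
    · rintro ⟨u, hu, t, ht, rfl⟩; exact ⟨u, hu, t, ht, rfl⟩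
  have htube : Ψ '' (A₀ ×ˢ V') = ⋃ u ∈ R, Ψ '' (A₀ ×ˢ ((fun t : ↥T => s t * u) '' Vu u)) := by
    rw [hV'eq]
    ext y
    simp only [mem_image, mem_prod, mem_iUnion, exists_prop, Prod.exists]
    constructor
    · rintro ⟨q, b, ⟨hq, u, hu, t, ht, rfl⟩, rfl⟩
      exact ⟨u, hu, q, s t * u, ⟨hq, t, ht, rfl⟩, rfl⟩
    · rintro ⟨u, hu, q, b, ⟨hq, t, ht, rfl⟩, rfl⟩
      exact ⟨q, s t * u, ⟨hq, u, hu, t, ht, rfl⟩, rfl⟩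
  have hsheetB₀ : ∀ u ∈ R, ∀ t ∈ Vu u, s t * u ∈ {b : ↥(Subgroup.centralizer ({(γ₀.val : GtLoc L v)} : Set (GtLoc L v))) | ∃ t : ↥T, IsRegularElt (((t : (UnitaryGroup.cmDatum L 3 (splitFormGL L : Matrix (Fin 3) (Fin 3) L)).Local v)).val : GtLoc L v) ∧ ∃ u ∈ R, b = s t * u} :=
    fun u hu t ht => ⟨t, ht.2.2, u, hu, rfl⟩
  have hsheetU : ∀ u ∈ R, ∀ t ∈ Vu u, s t * u ∈ (fun b : ↥(Subgroup.centralizer ({(γ₀.val : GtLoc L v)} : Set (GtLoc L v))) => epsNorm (epsLoc L (splitFormGL L) v) (b : GtLoc L v)) ⁻¹' (O ∩ O₁) :=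
    fun u hu t ht => (hV'sub ht.1).1
  -- Borel structure
  have hTtcl : IsClosed ((Subgroup.centralizer ({(γ₀.val : GtLoc L v)} : Set (GtLoc L v)) : Subgroup (GtLoc L v)) : Set (GtLoc L v)) :=
    Set.isClosed_centralizer _
  haveI : LocallyCompactSpace ↥(Subgroup.centralizer ({(γ₀.val : GtLoc L v)} : Set (GtLoc L v))) := hTtcl.isClosedEmbedding_subtypeVal.locallyCompactSpace
  haveI : PolishSpace ((GtLoc L v ⧸ epsCentralizer (epsLoc L (splitFormGL L) v) δ₀) × ↥(Subgroup.centralizer ({(γ₀.val : GtLoc L v)} : Set (GtLoc L v)))) :=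
    polishSpace_quotient_prod_param (epsCentralizer (epsLoc L (splitFormGL L) v) δ₀) (isClosed_epsCentralizer L (splitFormGL L) v δ₀)
  have hB₀m : MeasurableSet {b : ↥(Subgroup.centralizer ({(γ₀.val : GtLoc L v)} : Set (GtLoc L v))) | ∃ t : ↥T, IsRegularElt (((t : (UnitaryGroup.cmDatum L 3 (splitFormGL L : Matrix (Fin 3) (Fin 3) L)).Local v)).val : GtLoc L v) ∧ ∃ u ∈ R, b = s t * u} :=
    measurableSet_sheetTransversal hγ₀ hT s hsN R hRN hns hsm
  have hDm : MeasurableSet {p : (GtLoc L v ⧸ epsCentralizer (epsLoc L (splitFormGL L) v) δ₀) × ↥(Subgroup.centralizer ({(γ₀.val : GtLoc L v)} : Set (GtLoc L v))) | p.2 ∈ {b : ↥(Subgroup.centralizer ({(γ₀.val : GtLoc L v)} : Set (GtLoc L v))) | ∃ t : ↥T, IsRegularElt (((t : (UnitaryGroup.cmDatum L 3 (splitFormGL L : Matrix (Fin 3) (Fin 3) L)).Local v)).val : GtLoc L v) ∧ ∃ u ∈ R, b = s t * u}} := measurable_snd hB₀m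
  have hΨc : Continuous Ψ := (epsTube_smul_and_continuous Ψ hΨ).2
  have hLI := exists_isOpen_injOn_epsTube hns hγ₀ hδ₀T hδ₀reg Ψ hΨ N' hN' s hsN R hRN hRinj
  haveI : LocallyCompactSpace ((UnitaryGroup.cmDatum L 3 (splitFormGL L : Matrix (Fin 3) (Fin 3) L)).Local v) :=
    locallyCompactSpace_cmDatum_local (L := L) (N := 3) (H := (splitFormGL L : Matrix (Fin 3) (Fin 3) L)) (v := v)
  haveI : SecondCountableTopology (GL (Fin 3) (LocalRing L v)) := secondCountableTopology_localGL (E := L) 3 v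
  haveI : SecondCountableTopology ((UnitaryGroup.cmDatum L 3 (splitFormGL L : Matrix (Fin 3) (Fin 3) L)).Local v) := TopologicalSpace.Subtype.secondCountableTopology _
  haveI : PolishSpace ((UnitaryGroup.cmDatum L 3 (splitFormGL L : Matrix (Fin 3) (Fin 3) L)).Local v) :=
    Literature.Topology.Metrizable.polishSpace_of_locallyCompactSpace_of_secondCountableTopology _
  have hTcl : IsClosed (T : Set ((UnitaryGroup.cmDatum L 3 (splitFormGL L : Matrix (Fin 3) (Fin 3) L)).Local v)) := by
    rw [hT]; exact Set.isClosed_centralizer _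
  haveI : PolishSpace ↥T := hTcl.polishSpace
  have hsheetm : ∀ u ∈ R, MeasurableSet ((fun t : ↥T => s t * u) '' Vu u) := fun u hu =>
    (hVum u).image_of_measurable_injOn (hsm.mul_const u) (injective_sheet hγ₀ s hsN R hRN u hu).injOn
  have htubem : ∀ u ∈ R, MeasurableSet (Ψ '' (A₀ ×ˢ ((fun t : ↥T => s t * u) '' Vu u))) := by
    intro u hu
    have hsub : A₀ ×ˢ ((fun t : ↥T => s t * u) '' Vu u) ⊆ {p : (GtLoc L v ⧸ epsCentralizer (epsLoc L (splitFormGL L) v) δ₀) × ↥(Subgroup.centralizer ({(γ₀.val : GtLoc L v)} : Set (GtLoc L v))) | p.2 ∈ {b : ↥(Subgroup.centralizer ({(γ₀.val : GtLoc L v)} : Set (GtLoc L v))) | ∃ t : ↥T, IsRegularElt (((t : (UnitaryGroup.cmDatum L 3 (splitFormGL L : Matrix (Fin 3) (Fin 3) L)).Local v)).val : GtLoc L v) ∧ ∃ u ∈ R, b = s t * u}} := by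
      rintro ⟨q, b⟩ ⟨-, t, ht, rfl⟩; exact hsheetB₀ u hu t ht
    rw [← inter_eq_left.2 hsub]
    exact measurableSet_image_inter_of_locallyInjOn hDm hΨc (fun z _ => hLI z) (hA₀m.prod (hsheetm u hu))
  -- the tubes over distinct sheets are disjoint (injectivity patch + uniqueness of the sheet decomposition)
  have hdisj : (↑R : Set ↥(Subgroup.centralizer ({(γ₀.val : GtLoc L v)} : Set (GtLoc L v)))).PairwiseDisjoint fun u => Ψ '' (A₀ ×ˢ ((fun t : ↥T => s t * u) '' Vu u)) := by
    intro u hu u' hu' hne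
    refine Set.disjoint_left.2 fun y hy hy' => hne ?_
    obtain ⟨⟨q, b⟩, ⟨hq, t, ht, rfl⟩, rfl⟩ := hy
    obtain ⟨⟨q', b'⟩, ⟨hq', t', ht', rfl⟩, hyy⟩ := hy'
    have h1 : ((q', s t' * u') : (GtLoc L v ⧸ epsCentralizer (epsLoc L (splitFormGL L) v) δ₀) × ↥(Subgroup.centralizer ({(γ₀.val : GtLoc L v)} : Set (GtLoc L v)))) = (q, s t * u) :=
      hinjP ⟨⟨hq', hsheetU u' hu' t' ht'⟩, hsheetB₀ u' hu' t' ht'⟩ ⟨⟨hq, hsheetU u hu t ht⟩, hsheetB₀ u hu t ht⟩ hyy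
    have h2 : s t' * u' = s t * u := congrArg Prod.snd h1
    exact ((huniq t' t u' u hu' hu h2).2).symm
  -- left side: additivity over the sheets and the per-sheet letter
  have hL : νGt (Ψ '' (A₀ ×ˢ V')) = ∑ u ∈ R, (quotientMeasure (epsCentralizer (epsLoc L (splitFormGL L) v) δ₀) τ' (isClosed_epsCentralizer L (splitFormGL L) v δ₀) νGt) A₀ * ∫⁻ t in Vu u, (cartanWeight L v T t : ℝ≥0∞) ∂tT := by
    rw [htube, measure_biUnion_finset hdisj (fun u hu => htubem u hu)]
    exact Finset.sum_congr rfl fun u hu => hJ u hu (Vu u) (hVum u) (hVusub u)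
  -- right side: the sheet measure unpacked (part 1 `lintegral_sheetMeasure`) and the weight read through the sheets
  have hR' : ∫⁻ b in V', (Wt b : ℝ≥0∞) ∂(∑ u ∈ R, Measure.map (fun t : ↥T => s t * u) (tT.restrict {t : ↥T | IsRegularElt (((t : (UnitaryGroup.cmDatum L 3 (splitFormGL L : Matrix (Fin 3) (Fin 3) L)).Local v)).val : GtLoc L v)})) =
      ∑ u ∈ R, ∫⁻ t in Vu u, (cartanWeight L v T t : ℝ≥0∞) ∂tT := by
    rw [← lintegral_indicator hV'm, lintegral_sheetMeasure s R hsm (tT.restrict {t : ↥T | IsRegularElt (((t : (UnitaryGroup.cmDatum L 3 (splitFormGL L : Matrix (Fin 3) (Fin 3) L)).Local v)).val : GtLoc L v)}) ((hWtm.coe_nnreal_ennreal).indicator hV'm)]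
    refine Finset.sum_congr rfl fun u hu => ?_
    have hind : ∀ t : ↥T, V'.indicator (fun b => (Wt b : ℝ≥0∞)) (s t * u) =
        ((fun t : ↥T => s t * u) ⁻¹' V').indicator (fun t => (cartanWeight L v T t : ℝ≥0∞)) t := by
      intro t
      by_cases ht : s t * u ∈ V'
      · rw [indicator_of_mem ht, indicator_of_mem (show t ∈ (fun t : ↥T => s t * u) ⁻¹' V' from ht), hWt t u hu]
      · rw [indicator_of_notMem ht, indicator_of_notMem (show t ∉ (fun t : ↥T => s t * u) ⁻¹' V' from ht)]
    simp only [hind]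
    rw [lintegral_indicator ((hsm.mul_const u) hV'm), Measure.restrict_restrict ((hsm.mul_const u) hV'm)]
    -- `s⁻¹(V′)·u⁻¹ ∩ T^{reg} = V_u` (the `U`-clause is automatic for points of `V′`)
    have hset : (fun t : ↥T => s t * u) ⁻¹' V' ∩ {t : ↥T | IsRegularElt (((t : (UnitaryGroup.cmDatum L 3 (splitFormGL L : Matrix (Fin 3) (Fin 3) L)).Local v)).val : GtLoc L v)} = Vu u := by
      ext t
      constructor
      · rintro ⟨ht, htreg⟩
        obtain ⟨u', hu', t', ht', heq⟩ := (hmemV' _).1 ht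
        obtain ⟨htt, huu⟩ := huniq t t' u u' hu hu' heq
        subst htt; subst huu
        exact ht'
      · intro ht; exact ⟨ht.1, ht.2.2⟩
    rw [hset]
  rw [hL, hR', Finset.mul_sum]

/-! ## §2 The Bochner radial identity over the sheeted transversal -/

set_option maxHeartbeats 400000 in
-- instance-term unification on the CM local carrier (`G̃_v ⧸ T′`, `quotientMeasure`), as in ★ (E1b)
include hns hγ₀ hT hδ₀T hδ₀reg hΨ hN' hsm hsN hRN hRcov hRinj hWtm hWt in
/-- **THE BOCHNER RADIAL IDENTITY ON `B₀` FOR THE ε-TWISTED TUBE OF `T`** (★ M2♭ §2 fed with part 2a's (LI), (FC), continuity∕equivariance and §1): under (J̃♭) (hypothesis `hJac`,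
bytes of record), for every `g : G̃_v → E` that is `νGt`-integrable on the tube `Ψ(D)`: `(b, q) ↦ g(Ψ(q, b))` is integrable for `((λ|_{B₀}) · Wt) ⊗ μ₀`, and
**`∫_{b ∈ B₀} Wt(b) • ∫_{G̃_v ⧸ T′} g(Ψ(q, b)) dμ₀(q) dλ(b) = [Ñ^ε_T : T̃] • ∫_{Ψ(D)} g dνGt`** — the twisted Weyl integration formula of ONE tube with its radial measure identified on
the sheets, integrand still the plain pull-back. [cite: Rogawski1990, §12.5 p. 186] [cite: HarishChandra1970, Lemma 42] [cite: Federer1969, §2.10.10] -/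
theorem integrable_and_integral_epsTube_eq_of_sheetJacobian (νGt : Measure (GtLoc L v)) [νGt.IsHaarMeasure] [νGt.IsMulRightInvariant]
    (hJac : ∀ t₁ : ↥T, IsRegularElt (((t₁ : (UnitaryGroup.cmDatum L 3 (splitFormGL L : Matrix (Fin 3) (Fin 3) L)).Local v)).val : GtLoc L v) →
      ∃ U : Set ↥T, IsOpen U ∧ t₁ ∈ U ∧
      ∃ A₀ : Set (GtLoc L v ⧸ epsCentralizer (epsLoc L (splitFormGL L) v) δ₀), MeasurableSet A₀ ∧ (quotientMeasure (epsCentralizer (epsLoc L (splitFormGL L) v) δ₀) τ' (isClosed_epsCentralizer L (splitFormGL L) v δ₀) νGt) A₀ ≠ 0 ∧ (quotientMeasure (epsCentralizer (epsLoc L (splitFormGL L) v) δ₀) τ' (isClosed_epsCentralizer L (splitFormGL L) v δ₀) νGt) A₀ ≠ ⊤ ∧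
        ∀ u ∈ R, ∀ V : Set ↥T, MeasurableSet V → V ⊆ U ∩ {t : ↥T | IsRegularElt (((t : (UnitaryGroup.cmDatum L 3 (splitFormGL L : Matrix (Fin 3) (Fin 3) L)).Local v)).val : GtLoc L v)} →
          νGt (Ψ '' (A₀ ×ˢ ((fun t : ↥T => s t * u) '' V))) = (quotientMeasure (epsCentralizer (epsLoc L (splitFormGL L) v) δ₀) τ' (isClosed_epsCentralizer L (splitFormGL L) v δ₀) νGt) A₀ * ∫⁻ t in V, (cartanWeight L v T t : ℝ≥0∞) ∂tT)
    {E : Type*} [NormedAddCommGroup E] [NormedSpace ℝ E] (g : GtLoc L v → E)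
    (hg : IntegrableOn g (Ψ '' {p | p.2 ∈ {b : ↥(Subgroup.centralizer ({(γ₀.val : GtLoc L v)} : Set (GtLoc L v))) | ∃ t : ↥T, IsRegularElt (((t : (UnitaryGroup.cmDatum L 3 (splitFormGL L : Matrix (Fin 3) (Fin 3) L)).Local v)).val : GtLoc L v) ∧ ∃ u ∈ R, b = s t * u}}) νGt) :
    Integrable (fun p : ↥(Subgroup.centralizer ({(γ₀.val : GtLoc L v)} : Set (GtLoc L v))) × (GtLoc L v ⧸ epsCentralizer (epsLoc L (splitFormGL L) v) δ₀) => g (Ψ (p.2, p.1)))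
        (((((∑ u ∈ R, Measure.map (fun t : ↥T => s t * u) (tT.restrict {t : ↥T | IsRegularElt (((t : (UnitaryGroup.cmDatum L 3 (splitFormGL L : Matrix (Fin 3) (Fin 3) L)).Local v)).val : GtLoc L v)}))).restrict {b : ↥(Subgroup.centralizer ({(γ₀.val : GtLoc L v)} : Set (GtLoc L v))) | ∃ t : ↥T, IsRegularElt (((t : (UnitaryGroup.cmDatum L 3 (splitFormGL L : Matrix (Fin 3) (Fin 3) L)).Local v)).val : GtLoc L v) ∧ ∃ u ∈ R, b = s t * u}).withDensity fun b => (Wt b : ℝ≥0∞)).prod (quotientMeasure (epsCentralizer (epsLoc L (splitFormGL L) v) δ₀) τ' (isClosed_epsCentralizer L (splitFormGL L) v δ₀) νGt)) ∧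
      ∫ b in {b : ↥(Subgroup.centralizer ({(γ₀.val : GtLoc L v)} : Set (GtLoc L v))) | ∃ t : ↥T, IsRegularElt (((t : (UnitaryGroup.cmDatum L 3 (splitFormGL L : Matrix (Fin 3) (Fin 3) L)).Local v)).val : GtLoc L v) ∧ ∃ u ∈ R, b = s t * u}, (Wt b : ℝ) • ∫ q, g (Ψ (q, b)) ∂(quotientMeasure (epsCentralizer (epsLoc L (splitFormGL L) v) δ₀) τ' (isClosed_epsCentralizer L (splitFormGL L) v δ₀) νGt) ∂(∑ u ∈ R, Measure.map (fun t : ↥T => s t * u) (tT.restrict {t : ↥T | IsRegularElt (((t : (UnitaryGroup.cmDatum L 3 (splitFormGL L : Matrix (Fin 3) (Fin 3) L)).Local v)).val : GtLoc L v)})) =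
      ((((Subgroup.centralizer ({(γ₀.val : GtLoc L v)} : Set (GtLoc L v))).subgroupOf N').index : ℕ) : ℝ) •
        ∫ y in Ψ '' {p | p.2 ∈ {b : ↥(Subgroup.centralizer ({(γ₀.val : GtLoc L v)} : Set (GtLoc L v))) | ∃ t : ↥T, IsRegularElt (((t : (UnitaryGroup.cmDatum L 3 (splitFormGL L : Matrix (Fin 3) (Fin 3) L)).Local v)).val : GtLoc L v) ∧ ∃ u ∈ R, b = s t * u}}, g y ∂νGt := by
  classical
  have hΦ := splitFormGL_isHermitian L
  -- instances for ★ M2♭ at `B = T′`, `S = T̃`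
  have hTtcl : IsClosed ((Subgroup.centralizer ({(γ₀.val : GtLoc L v)} : Set (GtLoc L v)) : Subgroup (GtLoc L v)) : Set (GtLoc L v)) :=
    Set.isClosed_centralizer _
  haveI : LocallyCompactSpace ↥(Subgroup.centralizer ({(γ₀.val : GtLoc L v)} : Set (GtLoc L v))) := hTtcl.isClosedEmbedding_subtypeVal.locallyCompactSpace
  haveI : T1Space (GtLoc L v ⧸ epsCentralizer (epsLoc L (splitFormGL L) v) δ₀) := by
    haveI : IsClosed ((epsCentralizer (epsLoc L (splitFormGL L) v) δ₀ : Subgroup (GtLoc L v)) : Set (GtLoc L v)) :=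
      isClosed_epsCentralizer L (splitFormGL L) v δ₀
    infer_instance
  haveI : MeasurableSingletonClass (GtLoc L v ⧸ epsCentralizer (epsLoc L (splitFormGL L) v) δ₀) := ⟨fun x => isClosed_singleton.measurableSet⟩
  haveI : MeasurableSingletonClass ↥(Subgroup.centralizer ({(γ₀.val : GtLoc L v)} : Set (GtLoc L v))) := ⟨fun x => isClosed_singleton.measurableSet⟩
  -- the sheet measure is σ-finite (finite sum of push-forwards under measurable injections of the standard Borel `T`)
  haveI : LocallyCompactSpace ((UnitaryGroup.cmDatum L 3 (splitFormGL L : Matrix (Fin 3) (Fin 3) L)).Local v) :=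
    locallyCompactSpace_cmDatum_local (L := L) (N := 3) (H := (splitFormGL L : Matrix (Fin 3) (Fin 3) L)) (v := v)
  haveI : SecondCountableTopology (GL (Fin 3) (LocalRing L v)) := secondCountableTopology_localGL (E := L) 3 v
  haveI : SecondCountableTopology ((UnitaryGroup.cmDatum L 3 (splitFormGL L : Matrix (Fin 3) (Fin 3) L)).Local v) := TopologicalSpace.Subtype.secondCountableTopology _
  haveI : PolishSpace ((UnitaryGroup.cmDatum L 3 (splitFormGL L : Matrix (Fin 3) (Fin 3) L)).Local v) :=
    Literature.Topology.Metrizable.polishSpace_of_locallyCompactSpace_of_secondCountableTopology _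
  have hTcl : IsClosed (T : Set ((UnitaryGroup.cmDatum L 3 (splitFormGL L : Matrix (Fin 3) (Fin 3) L)).Local v)) := by
    rw [hT]; exact Set.isClosed_centralizer _
  haveI : PolishSpace ↥T := hTcl.polishSpace
  haveI : SigmaFinite (∑ u ∈ R, Measure.map (fun t : ↥T => s t * u) (tT.restrict {t : ↥T | IsRegularElt (((t : (UnitaryGroup.cmDatum L 3 (splitFormGL L : Matrix (Fin 3) (Fin 3) L)).Local v)).val : GtLoc L v)})) := by
    have hemb : ∀ u ∈ R, MeasurableEmbedding (fun t : ↥T => s t * u) := fun u hu =>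
      (hsm.mul_const u).measurableEmbedding (injective_sheet hγ₀ s hsN R hRN u hu)
    haveI : ∀ u : ↥R, SigmaFinite (Measure.map (fun t : ↥T => s t * (u : ↥(Subgroup.centralizer ({(γ₀.val : GtLoc L v)} : Set (GtLoc L v))))) (tT.restrict {t : ↥T | IsRegularElt (((t : (UnitaryGroup.cmDatum L 3 (splitFormGL L : Matrix (Fin 3) (Fin 3) L)).Local v)).val : GtLoc L v)})) :=
      fun u => (hemb u u.2).sigmaFinite_map
    rw [← Finset.sum_coe_sort, ← Measure.sum_fintype]
    infer_instance
  obtain ⟨hsmul, hcont⟩ := epsTube_smul_and_continuous Ψ hΨ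
  exact integrable_and_integral_eq_of_tubeJacobian_local (epsCentralizer (epsLoc L (splitFormGL L) v) δ₀) (isClosed_epsCentralizer L (splitFormGL L) v δ₀) νGt Ψ hcont
    (fun c : GtLoc L v => (epsLoc L (splitFormGL L) v c)⁻¹) hsmul _ (measurableSet_sheetTransversal hγ₀ hT s hsN R hRN hns hsm)
    (fun z _ => exists_isOpen_injOn_epsTube hns hγ₀ hδ₀T hδ₀reg Ψ hΨ N' hN' s hsN R hRN hRinj z) _
    (fun y hy => count_fibre_epsTube_eq hns hγ₀ hT hδ₀T hδ₀reg Ψ hΨ N' hN' s hsN R hRN hRcov hRinj hy) τ' _ Wt hWtm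
    (hJac_sheet_to_radial hns hγ₀ hT hδ₀T hδ₀reg Ψ hΨ N' hN' s hsm hsN R hRN hRinj tT Wt hWtm hWt τ' νGt hJac) g hg

end Radial

end Summit.HodgeConjecture.HodgeConjecture.R90.S4

end
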